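import Summits.BirchSwinnertonDyer.Rank1Residual.X12.O11.RouteUPsiD11
import Summits.BirchSwinnertonDyer.Rank1Residual.X12.O11.RouteUTwistCM
import Summits.BirchSwinnertonDyer.Rank1Residual.X12.CMRamifiedAdditive
import Summits.BirchSwinnertonDyer.Rank1Residual.Additive.AdditiveTorsionFiveSeven
import Mathlib.NumberTheory.LegendreSymbol.Basic
import HarnessLib

/-!
# ROUTE U — local descent inputs for the twists of `49a1`: no `7`-torsion over the Heegner field
# (Mazur's step at the additive prime `7`), the values of `θ₁ = χ_q↑·(ω⁴)↑`, `−q` fundamental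

bsd-cm cell (run/shared/lean/pub/bsd-cm/), ROUTE U (Theorem U: BSD(49a1^{(D)}, 7) ⇒ full BSD on `𝒞₇`),
seat `bsd-cm-ram`; planner ORDER «`RouteUSelmerPiDescentBG85`: the descent binders `hSel`/`hiv` of the
member theorems». This module holds the parts that need only landed modules; the Buhler–Gross step
(`7 ∤ #Ш(W)` by name) is in `RouteUPrimeMember` §0. THEOREMS ONLY; nothing booked.

* `padicValRat_c₆_ne_one_of_twist_cm7` — every model `W` of `49a1^{(D)}` has `v₇(c₆(W)) ≡ 2 (mod 3)`,
  in particular `≠ 1` (`c₆(49a1) = 1323 = 3³·7²`): the twists of `49a1` avoid the exceptional locus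
  (Kodaira II at `7`) of Mazur's local torsion step;
* **`noSevenTorsion_baseChange_of_twist_cm7`** — for `W` a globally minimal model of `49a1^{(D)}` and
  ANY number field `K` with an embedding `K ↪ ℚ₇`: `W(K)[7] = 0` (`W(K) ↪ W(ℚ₇)`, and `W(ℚ₇)[7] = 0`
  by the tree theorem `Additive.eq_zero_of_prime_nsmul_eq_zero_of_addv` — additive `p ≥ 5` off
  `v₇(c₆) = 1`; additivity at `7` from CM by `ℚ(√−7)`, `X12.addv_of_hasCM_of_cmRamified`). This
  DISCHARGES the binder `hiv` («no `7`-torsion over `K`») of T-U5′ / the member theorems;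
* `thetaOnePrime_apply` — values `θ₁(j) = (j/q)·ω(j)⁴` of `χ_q↑·(ω⁴)↑` at level `7q` (the character
  `χ_Mω⁴` of Buhler–Gross (8.3)(1) for `M = ℚ(√−q)`);
* `isFundamental_neg_prime` — `−q` is a fundamental discriminant for a prime `q ≡ 3 (mod 4)`.

References: [Mazur1977] Ch. III §5 Step 1 (p. 158); [SilvermanAEC2009] III.1, VII.3.1, X.5;
[BuhlerGross1985] Ch. II (8.3); [KrizLi2019] §2 (p. 11).
-/

noncomputable section

open scoped Classical
open NumberField WeierstrassCurve DirichletCharacter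
open Literature.NumberTheory.EllipticCurves Literature.NumberTheory.EllipticCurves.Rank1Residual
open Literature.NumberTheory.EllipticCurves.KrizLi2019

namespace Summit.BirchSwinnertonDyer.Rank1Residual.X12.O11.RouteU

/-! ## §1 Mazur's local step at `7` for the twists of `49a1` -/

/-- **`v₇(c₆(W)) ≠ 1` for every model `W` of a quadratic twist `49a1^{(D)}`** (`D ≠ 0`):
`c₆(W) = u⁶·D³·c₆(49a1)` with `c₆(49a1) = 1323 = 3³·7²`, so `v₇(c₆(W)) ≡ 2 (mod 3)` — the twists of
`49a1` avoid the exceptional locus (Kodaira II at `7`, `v₇(c₆) = 1`) of Mazur's local torsion step.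
[cite: SilvermanAEC2009, III.1 (c₄, c₆ under a change of variables) and X.5 (twists)] -/
theorem padicValRat_c₆_ne_one_of_twist_cm7 (W : WeierstrassCurve ℚ) {D : ℚ} (hD : D ≠ 0)
    (hW : ∃ C : VariableChange ℚ, C • W = cm7.quadraticTwist D) : padicValRat 7 W.c₆ ≠ 1 := by
  haveI : Fact (Nat.Prime 7) := ⟨by norm_num⟩
  obtain ⟨C, hC⟩ := hW
  have hc : cm7.c₆ = 1323 := by
    norm_num [cm7, WeierstrassCurve.c₆, WeierstrassCurve.b₂, WeierstrassCurve.b₄, WeierstrassCurve.b₆]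
  have hu0 : (C.u : ℚ) ≠ 0 := C.u.ne_zero
  have h1 : W.c₆ = (C.u : ℚ) ^ 6 * (D ^ 3 * 1323) := by
    have h := congrArg WeierstrassCurve.c₆ hC
    rw [variableChange_c₆, quadraticTwist_c₆, hc] at h
    have hu : ((C.u⁻¹ : ℚˣ) : ℚ) ^ 6 * (C.u : ℚ) ^ 6 = 1 := by
      rw [← mul_pow, Units.inv_mul, one_pow]
    calc W.c₆ = ((C.u⁻¹ : ℚˣ) : ℚ) ^ 6 * (C.u : ℚ) ^ 6 * W.c₆ := by rw [hu, one_mul]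
      _ = (C.u : ℚ) ^ 6 * (((C.u⁻¹ : ℚˣ) : ℚ) ^ 6 * W.c₆) := by ring
      _ = (C.u : ℚ) ^ 6 * (D ^ 3 * 1323) := by rw [h]
  have h27 : padicValRat 7 (27 : ℚ) = 0 := by
    rw [show (27 : ℚ) = ((27 : ℕ) : ℚ) by norm_num, padicValRat.of_nat]
    exact_mod_cast padicValNat.eq_zero_of_not_dvd (by norm_num)
  have h7 : padicValRat 7 (7 : ℚ) = 1 := by
    have := padicValRat.self (p := 7) (by norm_num); simpa using this
  have h1323 : padicValRat 7 (1323 : ℚ) = 2 := by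
    rw [show (1323 : ℚ) = (7 : ℚ) ^ 2 * 27 by norm_num, padicValRat.mul (by norm_num) (by norm_num),
      padicValRat.pow (7 : ℚ), h7, h27]
    norm_num
  rw [h1, padicValRat.mul (pow_ne_zero _ hu0) (mul_ne_zero (pow_ne_zero _ hD) (by norm_num)),
    padicValRat.mul (pow_ne_zero _ hD) (by norm_num), padicValRat.pow (C.u : ℚ), padicValRat.pow D, h1323]
  push_cast
  omega

/-- **No `7`-torsion over the Heegner field `K` for a globally minimal model `W` of `49a1^{(D)}`**,
`K` any number field with an embedding `K ↪ ℚ₇` (e.g. `7` split in `K`): `W(K) ↪ W(ℚ₇)` and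
`W(ℚ₇)[7] = 0` by Mazur's step at the ADDITIVE prime `7` (tree theorem
`Additive.eq_zero_of_prime_nsmul_eq_zero_of_addv`: additive `p ≥ 5` off the locus `v₇(c₆) = 1`,
excluded by `padicValRat_c₆_ne_one_of_twist_cm7`; additivity from CM by `ℚ(√−7)`,
`X12.addv_of_hasCM_of_cmRamified`). This DISCHARGES the binder `hiv` of T-U5′ / of the member
theorems. [cite: Mazur1977, Ch. III §5, Step 1 (p. 158)] [cite: SilvermanAEC2009, VII.3 Prop. 3.1] -/
theorem noSevenTorsion_baseChange_of_twist_cm7 (W : WeierstrassCurve ℚ) [W.IsElliptic]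
    [W.IsGloballyMinimal] {D : ℤ} (hD : D ≠ 0)
    (hW : ∃ C : VariableChange ℚ, C • W = cm7.quadraticTwist (D : ℚ))
    (K : Type) [Field K] [NumberField K] (ιp : K →+* ℚ_[7]) :
    ∀ x : (W.baseChange K).toAffine.Point, 7 • x = 0 → x = 0 := by
  haveI : Fact (Nat.Prime 7) := ⟨by norm_num⟩
  have hCM : W.HasCM := hasCM_of_twist_cm7 W hD hW
  have hKj : cmFieldDiscrOfJ W.j = -7 := cmFieldDiscrOfJ_of_twist_cm7 W hD hW
  have hadd : Addv W 7 :=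
    X12.addv_of_hasCM_of_cmRamified W 7 hCM (by norm_num) (by rw [CMRamified, hKj]; norm_num)
  have hc6 : padicValRat 7 W.c₆ ≠ 1 :=
    padicValRat_c₆_ne_one_of_twist_cm7 W (by exact_mod_cast hD) hW
  intro x hx
  have hinj := WeierstrassCurve.Affine.Point.map_injective (W' := W) ιp.toRatAlgHom
  apply hinj
  rw [map_zero]
  exact Additive.eq_zero_of_prime_nsmul_eq_zero_of_addv W 7 (by norm_num) hadd (fun h => by omega)
    (fun _ => hc6) (by rw [← map_nsmul, hx, map_zero])

/-! ## §2 The character `θ₁ = χ_q↑·(ω⁴)↑` and the discriminant `−q` -/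

section ThetaOne

variable {q : ℕ} [hq : Fact q.Prime] (ω : DirichletCharacter ℚ_[7] 7) (χ : DirichletCharacter ℚ_[7] q)

/-- **Values of `θ₁ = χ↑·(ω⁴)↑` at level `7q`: `θ₁(j) = (j/q)·ω(j)⁴`** (units: `changeLevel`;
non-units: both sides vanish) — the character `χ_Mω⁴` of Buhler–Gross (8.3)(1) for `M = ℚ(√−q)`.
[cite: BuhlerGross1985, Ch. II Prop. (8.3)(1) (p. 17)] [cite: KrizLi2019, §2 (p. 11, conventions on characters)] -/
theorem thetaOnePrime_apply
    (hχ : ∀ a : ℕ, χ (a : ZMod q) = (legendreSym q (a : ℤ) : ℚ_[7])) (j : ZMod (7 * q)) :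
    (changeLevel (dvd_mul_left q 7) χ * changeLevel (dvd_mul_right 7 q) (ω ^ 4) :
      DirichletCharacter ℚ_[7] (7 * q)) j =
      (legendreSym q (j.val : ℤ) : ℚ_[7]) * ω (j.val : ZMod 7) ^ 4 := by
  have hj : ((j.val : ℤ) : ZMod (7 * q)) = j := by rw [Int.cast_natCast, ZMod.natCast_zmod_val]
  by_cases hu : IsCoprime (j.val : ℤ) ((7 * q : ℕ) : ℤ)
  · conv_lhs => rw [← hj]
    rw [MulChar.mul_apply, changeLevel_eq_cast_of_dvd' _ _ hu, changeLevel_eq_cast_of_dvd' _ _ hu,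
      MulChar.pow_apply' _ (by norm_num : (4 : ℕ) ≠ 0), Int.cast_natCast, Int.cast_natCast, hχ]
  · have hnu : ¬ IsUnit j := by
      rw [← hj, ZMod.coe_int_isUnit_iff_isCoprime]; exact fun h => hu (by simpa [isCoprime_comm] using h)
    rw [MulChar.map_nonunit _ hnu]
    have h77 : ¬ (j.val).Coprime (7 * q) := fun h => hu (Nat.isCoprime_iff_coprime.mpr h)
    rw [Nat.coprime_mul_iff_right, not_and_or] at h77
    rcases h77 with h7 | h11
    · have hd : 7 ∣ j.val := by
        rwa [Nat.coprime_comm, Nat.Prime.coprime_iff_not_dvd (by norm_num), not_not] at h7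
      have h0 : (j.val : ZMod 7) = 0 := (ZMod.natCast_eq_zero_iff _ _).mpr hd
      rw [h0, MulChar.map_zero, zero_pow (by norm_num), mul_zero]
    · have hd : q ∣ j.val := by
        rwa [Nat.coprime_comm, Nat.Prime.coprime_iff_not_dvd hq.out, not_not] at h11
      have h0 : legendreSym q (j.val : ℤ) = 0 :=
        (legendreSym.eq_zero_iff q _).mpr (by
          rw [Int.cast_natCast]; exact (ZMod.natCast_eq_zero_iff _ _).mpr hd)
      rw [h0, Int.cast_zero, zero_mul]

/-- `−q` is a fundamental discriminant for a prime `q ≡ 3 (mod 4)`. [folklore] -/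
theorem isFundamental_neg_prime (hq4 : q % 4 = 3) :
    ((-(q : ℤ)) % 4 = 1 ∧ Squarefree (-(q : ℤ)) ∧ (-(q : ℤ)) ≠ 1) ∨
      (4 ∣ (-(q : ℤ)) ∧ ((-(q : ℤ)) / 4 % 4 = 2 ∨ (-(q : ℤ)) / 4 % 4 = 3) ∧
        Squarefree ((-(q : ℤ)) / 4)) := by
  refine Or.inl ⟨?_, ?_, ?_⟩
  · have : ((q : ℤ) % 4) = 3 := by exact_mod_cast hq4
    omega
  · rw [← Int.squarefree_natAbs]; simpa using hq.out.squarefree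
  · have := hq.out.pos; omega

end ThetaOne

end Summit.BirchSwinnertonDyer.Rank1Residual.X12.O11.RouteU

end
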